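import Summits.BirchSwinnertonDyer.BirchSwinnertonDyer.Theorems.SmallImageMuTransferMuTransferStubX9LevelE
import Literature.NumberTheory.EllipticCurves.IwasawaTwistModP
import HarnessLib

/-!
# K6 crux `MuTransferX9` (stmt-BirchSwinnertonDyer-19276), stub `stub_coreX9`: MU-TRANSFER-PROOF §4
# Lemma 3 (i) on the GENUINE modules `𝒯_J(E) = E[p] ⊗ 𝔽_p[T]/(T^J)(χ_κ)` — the `Γ_F`-stable subgroups of
# `𝒯_J` are exactly the `T^j 𝒯_J`

Cell `bsd-smallim`, seat `bsd-smallim-k6-c2` (gen 2). HONEST FRAMING: theorems only (no definition, no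
named fact); nothing asserted about any curve; BSD is not advanced. CORE-PLAN §3 (Step 1 of the cell's
Theorem A): the images `im h ⊂ 𝒯_e`, `im h^* ⊂ 𝒯_e^*` of the restricted test classes are `Γ`-stable
subgroups, and MU-TRANSFER-PROOF §4 Lemma 3 (i) identifies all such subgroups as `T^j 𝒯_e`.  The
ALGEBRA of Lemma 3 (i) is the tree's kernel theorem `LevelE.shiftStable_submodule_eq_tPow` (p419228; from
IRREDUCIBILITY alone, in coordinates `Fin e → V` over an abstract field); this file instantiates it on the
genuine Galois module `WeierstrassCurve.modPTwist W p κ J` (= `κ.twistModP (E[p]) J`, file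
`IwasawaTwistModP`, seat k6-ty): for `E[p]` irreducible (`W.HasIrreducibleModPGaloisRep p`) and a
topological generator `γ₀` of `κ` acting trivially on `E[p]` (exists whenever `F(E[p]) ∩ F_∞ = F`, e.g.
`p ∤ #ρ̄(Γ_F)` — the X9 images; MU-TRANSFER-PROOF (F2)/(F8) "`G ↠ Ḡ × Γ_e`"), every subgroup
`N ≤ 𝒯_J` stable under the twisted action is `{x | x_i = 0 for i < j} = T^j 𝒯_J` for a unique `j ≤ J`.
Proof: `γ₀` acts as `1 + S` (`modPTwist_apply_of_isTopGenerator`), so `N` is `S`-stable; every `σ` acts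
as `(1+S)^{κ(σ)} ∘ ρ̄(σ)`, and `(1+S)^{p^J} = 1`, so `N` is stable under the diagonal `ρ̄(σ)`; `E[p]` is a
`ZMod p`-module on which `{ρ̄(σ)}` acts irreducibly; apply `shiftStable_submodule_eq_tPow`.

References: HOME/koly/MU-TRANSFER-PROOF.md §4 Lemma 3 (i), (F2), (F8); L. Washington, *Introduction to
Cyclotomic Fields* §13.2 [Washington1997]; B. Mazur, K. Rubin, Mem. AMS 799 §5.3 [MazurRubin2004].
-/

-- the summit and its single problem are both named `BirchSwinnertonDyer` (registry layout D-0017)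
set_option linter.dupNamespace false

set_option autoImplicit false

noncomputable section

open Literature.NumberTheory.EllipticCurves Literature.NumberTheory.GaloisRepresentations Field

universe u

namespace Summit.BirchSwinnertonDyer.BirchSwinnertonDyer.Rank1Residual.LevelE

variable {F : Type u} [Field F] (W : WeierstrassCurve F) (p : ℕ) [Fact p.Prime]
  (κ : ZpExtension F p) (J : ℕ)

/-- **A `Γ_F`-stable subgroup of `𝒯_J(E)` is stable under the shift `S` (multiplication by `T`)**, as
soon as some topological generator `γ₀` of `κ` acts trivially on `E[p]`: `γ₀` acts on `𝒯_J` as `1 + S`.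
[cite: Washington1997, §13.1–§13.2] -/
theorem shiftEnd_mem_of_modPTwist_stable {γ₀ : absoluteGaloisGroup F} (hγ₀ : κ.IsTopGenerator γ₀)
    (hγ₀E : ∀ P : WeierstrassCurve.geomTorsion W (p : ℤ), γ₀ • P = P)
    (N : AddSubgroup (Fin J → WeierstrassCurve.geomTorsion W (p : ℤ)))
    (hN : ∀ (σ : absoluteGaloisGroup F) (x : Fin J → WeierstrassCurve.geomTorsion W (p : ℤ)),
      x ∈ N → W.modPTwist p κ J σ x ∈ N)
    {x : Fin J → WeierstrassCurve.geomTorsion W (p : ℤ)} (hx : x ∈ N) :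
    shiftEnd (WeierstrassCurve.geomTorsion W (p : ℤ)) J x ∈ N := by
  have h1 : W.modPTwist p κ J γ₀ x = x + shiftEnd (WeierstrassCurve.geomTorsion W (p : ℤ)) J x := by
    rw [WeierstrassCurve.modPTwist_apply_of_isTopGenerator W p κ J hγ₀]
    have : (fun i => γ₀ • x i) = x := funext fun i => hγ₀E (x i)
    rw [this, LinearMap.add_apply, Module.End.one_apply]
  have h2 := hN γ₀ x hx
  rw [h1] at h2
  simpa using N.sub_mem h2 hx

/-- **Iterates of `1 + S` preserve a `Γ_F`-stable subgroup of `𝒯_J(E)`** (under the same hypothesis).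
[cite: Washington1997, §13.1–§13.2] -/
theorem unipotentPow_mem_of_modPTwist_stable {γ₀ : absoluteGaloisGroup F} (hγ₀ : κ.IsTopGenerator γ₀)
    (hγ₀E : ∀ P : WeierstrassCurve.geomTorsion W (p : ℤ), γ₀ • P = P)
    (N : AddSubgroup (Fin J → WeierstrassCurve.geomTorsion W (p : ℤ)))
    (hN : ∀ (σ : absoluteGaloisGroup F) (x : Fin J → WeierstrassCurve.geomTorsion W (p : ℤ)),
      x ∈ N → W.modPTwist p κ J σ x ∈ N)
    (a : ℕ) {x : Fin J → WeierstrassCurve.geomTorsion W (p : ℤ)} (hx : x ∈ N) :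
    unipotentPow (WeierstrassCurve.geomTorsion W (p : ℤ)) J a x ∈ N := by
  induction a generalizing x with
  | zero => simpa [unipotentPow_zero] using hx
  | succ a ih =>
    rw [unipotentPow_add, Module.End.mul_apply]
    refine ih ?_
    have h1 : unipotentPow (WeierstrassCurve.geomTorsion W (p : ℤ)) J 1 x =
        x + shiftEnd (WeierstrassCurve.geomTorsion W (p : ℤ)) J x := by
      simp only [unipotentPow, pow_one, LinearMap.add_apply, Module.End.one_apply]
    rw [h1]
    exact N.add_mem hx (shiftEnd_mem_of_modPTwist_stable W p κ J hγ₀ hγ₀E N hN hx)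

/-- **A `Γ_F`-stable subgroup of `𝒯_J(E)` is stable under the DIAGONAL action `x ↦ (σ • x_i)_i` of every
`σ ∈ Γ_F`** (under the same hypothesis): `σ` acts on `𝒯_J` by `(1+S)^{κ(σ)} ∘ diag(σ)` and
`(1+S)^{p^J} = 1`, so `diag(σ) x = (1+S)^{p^J − κ(σ) mod p^J} (σ · x)`. [cite: Washington1997, §13.1–§13.2] -/
theorem diag_smul_mem_of_modPTwist_stable {γ₀ : absoluteGaloisGroup F} (hγ₀ : κ.IsTopGenerator γ₀)
    (hγ₀E : ∀ P : WeierstrassCurve.geomTorsion W (p : ℤ), γ₀ • P = P)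
    (N : AddSubgroup (Fin J → WeierstrassCurve.geomTorsion W (p : ℤ)))
    (hN : ∀ (σ : absoluteGaloisGroup F) (x : Fin J → WeierstrassCurve.geomTorsion W (p : ℤ)),
      x ∈ N → W.modPTwist p κ J σ x ∈ N)
    (σ : absoluteGaloisGroup F) {x : Fin J → WeierstrassCurve.geomTorsion W (p : ℤ)} (hx : x ∈ N) :
    (fun i => σ • x i) ∈ N := by
  have hM : ∀ P : WeierstrassCurve.geomTorsion W (p : ℤ), p • P = 0 := fun P =>
    AddSubgroup.torsionBy.nsmul P
  have hJ : J ≤ p ^ J := (Nat.lt_pow_self (Fact.out : p.Prime).one_lt).le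
  set a := κ.twistExponent J σ with ha
  have ha_lt : a ≤ p ^ J := by
    rw [ha, ZpExtension.twistExponent]
    exact (ZMod.val_lt _).le
  have key : unipotentPow (WeierstrassCurve.geomTorsion W (p : ℤ)) J (p ^ J - a) (W.modPTwist p κ J σ x) =
      fun i => σ • x i := by
    rw [WeierstrassCurve.modPTwist_apply, ← Module.End.mul_apply, ← unipotentPow_add,
      Nat.sub_add_cancel ha_lt, unipotentPow_prime_pow_eq_one hM hJ, Module.End.one_apply]
  rw [← key]
  exact unipotentPow_mem_of_modPTwist_stable W p κ J hγ₀ hγ₀E N hN _ (hN σ x hx)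

/-- **MU-TRANSFER-PROOF §4 Lemma 3 (i) on the GENUINE module `𝒯_J(E) = E[p] ⊗ 𝔽_p[T]/(T^J)(χ_κ)`:**
if `E[p]` is irreducible and some topological generator `γ₀` of `κ` acts trivially on `E[p]`, then every
subgroup `N ≤ 𝒯_J(E)` stable under the (twisted) action of `Γ_F` is `T^j 𝒯_J(E) = {x | x_i = 0 for all
i < j}` for some `j ≤ J`.  Instance of the kernel lemma `LevelE.shiftStable_submodule_eq_tPow` (abstract
Lemma 3 (i), irreducibility only) over `k = ZMod p`, `V = E[p]`, `S = {ρ̄(σ)}`.  This is the input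
"`im h = T^j 𝒯_e`, `im h^* = T^j 𝒯_e^*`" of MU-TRANSFER-PROOF §5 Step 1 (for `𝒯_e`; the dual statement
is the same lemma for the dual twist). [cite: MazurRubin2004, §5.3] -/
theorem modPTwist_stable_addSubgroup_eq_tPow (hirr : W.HasIrreducibleModPGaloisRep p)
    {γ₀ : absoluteGaloisGroup F} (hγ₀ : κ.IsTopGenerator γ₀)
    (hγ₀E : ∀ P : WeierstrassCurve.geomTorsion W (p : ℤ), γ₀ • P = P)
    (N : AddSubgroup (Fin J → WeierstrassCurve.geomTorsion W (p : ℤ)))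
    (hN : ∀ (σ : absoluteGaloisGroup F) (x : Fin J → WeierstrassCurve.geomTorsion W (p : ℤ)),
      x ∈ N → W.modPTwist p κ J σ x ∈ N) :
    ∃ j : ℕ, j ≤ J ∧ ∀ x : Fin J → WeierstrassCurve.geomTorsion W (p : ℤ),
      x ∈ N ↔ ∀ i : Fin J, i.val < j → x i = 0 := by
  classical
  -- `E[p] = (geomPoints W)[p]` as a `ZMod p`-vector space (Mathlib's reducible non-instance)
  letI : Module (ZMod p) (WeierstrassCurve.geomTorsion W (p : ℤ)) := AddSubgroup.torsionBy.zmodModule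
  -- the operators `ρ̄(σ)` as `ZMod p`-linear maps, the shift, and `N` as a `ZMod p`-submodule
  let ρσ : absoluteGaloisGroup F →
      (WeierstrassCurve.geomTorsion W (p : ℤ) →ₗ[ZMod p] WeierstrassCurve.geomTorsion W (p : ℤ)) :=
    fun σ => (DistribSMul.toAddMonoidHom (WeierstrassCurve.geomTorsion W (p : ℤ)) σ).toZModLinearMap p
  let T : (Fin J → WeierstrassCurve.geomTorsion W (p : ℤ)) →ₗ[ZMod p]
      (Fin J → WeierstrassCurve.geomTorsion W (p : ℤ)) :=
    (shiftEnd (WeierstrassCurve.geomTorsion W (p : ℤ)) J).toAddMonoidHom.toZModLinearMap p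
  let N' : Submodule (ZMod p) (Fin J → WeierstrassCurve.geomTorsion W (p : ℤ)) :=
    AddSubgroup.toZModSubmodule p N
  have hN'mem : ∀ x, x ∈ N' ↔ x ∈ N := fun x => AddSubgroup.mem_toZModSubmodule p
  have hirr' : ∀ W' : Submodule (ZMod p) (WeierstrassCurve.geomTorsion W (p : ℤ)),
      (∀ g ∈ Set.range ρσ, ∀ v ∈ W', g v ∈ W') → W' = ⊥ ∨ W' = ⊤ := by
    intro W' hW'
    have hstab : ∀ σ : absoluteGaloisGroup F, ∀ P ∈ W'.toAddSubgroup, σ • P ∈ W'.toAddSubgroup :=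
      fun σ P hP => hW' (ρσ σ) ⟨σ, rfl⟩ P hP
    rcases hirr W'.toAddSubgroup hstab with h | h
    · left
      apply Submodule.toAddSubgroup_injective
      rw [h, Submodule.bot_toAddSubgroup]
    · right
      apply Submodule.toAddSubgroup_injective
      rw [h, Submodule.top_toAddSubgroup]
  have hT0 : ∀ (x : Fin J → WeierstrassCurve.geomTorsion W (p : ℤ)) (i : Fin J), i.val = 0 → T x i = 0 := by
    intro x i hi
    change shiftEnd (WeierstrassCurve.geomTorsion W (p : ℤ)) J x i = 0
    rw [shiftEnd_apply, dif_pos hi]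
  have hTs : ∀ (x : Fin J → WeierstrassCurve.geomTorsion W (p : ℤ)) (i j : Fin J),
      j.val = i.val + 1 → T x j = x i := by
    intro x i j hij
    change shiftEnd (WeierstrassCurve.geomTorsion W (p : ℤ)) J x j = x i
    rw [shiftEnd_apply, dif_neg (by omega)]
    congr 1
    ext
    simp only [hij, Nat.add_sub_cancel]
  have hNT : ∀ x ∈ N', T x ∈ N' := by
    intro x hx
    rw [hN'mem] at hx ⊢
    exact shiftEnd_mem_of_modPTwist_stable W p κ J hγ₀ hγ₀E N hN hx
  have hNS : ∀ g ∈ Set.range ρσ, ∀ x ∈ N', (fun i => g (x i)) ∈ N' := by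
    rintro g ⟨σ, rfl⟩ x hx
    rw [hN'mem] at hx ⊢
    exact diag_smul_mem_of_modPTwist_stable W p κ J hγ₀ hγ₀E N hN σ hx
  obtain ⟨j, hj, hiff⟩ := shiftStable_submodule_eq_tPow (Set.range ρσ) hirr' T hT0 hTs N' hNT hNS
  exact ⟨j, hj, fun x => (hN'mem x).symm.trans (hiff x)⟩

/-! ## Append (gen 2, no. 1): the hypothesis weakened to "some `σ₀` fixing `E[p]` has `κ(σ₀)` a unit",
and its discharge from "the image of `Γ_F` on `E[p]` has exponent prime to `p`" (the X9 images) -/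

omit [Fact (Nat.Prime p)] in
/-- **A subgroup of `𝒯_J(E)` stable under `1 + S` is stable under `S` and under all `(1+S)^a`.**
[cite: Washington1997, §13.1–§13.2] -/
theorem unipotentPow_mem_of_add_shift_mem
    (N : AddSubgroup (Fin J → WeierstrassCurve.geomTorsion W (p : ℤ)))
    (hS : ∀ x ∈ N, x + shiftEnd (WeierstrassCurve.geomTorsion W (p : ℤ)) J x ∈ N)
    (a : ℕ) {x : Fin J → WeierstrassCurve.geomTorsion W (p : ℤ)} (hx : x ∈ N) :
    unipotentPow (WeierstrassCurve.geomTorsion W (p : ℤ)) J a x ∈ N := by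
  induction a generalizing x with
  | zero => simpa [unipotentPow_zero] using hx
  | succ a ih =>
    rw [unipotentPow_add, Module.End.mul_apply]
    refine ih ?_
    have h1 : unipotentPow (WeierstrassCurve.geomTorsion W (p : ℤ)) J 1 x =
        x + shiftEnd (WeierstrassCurve.geomTorsion W (p : ℤ)) J x := by
      simp only [unipotentPow, pow_one, LinearMap.add_apply, Module.End.one_apply]
    rw [h1]
    exact hS x hx

/-- **If `σ₀ ∈ Γ_F` fixes `E[p]` and `κ(σ₀) mod p^J` is prime to `p`, a `Γ_F`-stable subgroup of `𝒯_J(E)`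
is stable under `1 + S`**: `σ₀` acts as `(1+S)^u`, `u = κ(σ₀) mod p^J`, and `(1+S) = ((1+S)^u)^v` for
`u v ≡ 1 (mod p^J)` since `(1+S)^{p^J} = 1`.  (MU-TRANSFER-PROOF (F2)/(F8): `G ↠ Ḡ × Γ_e`.)
[cite: Washington1997, §13.1–§13.2] -/
theorem add_shift_mem_of_modPTwist_stable_of_unit {σ₀ : absoluteGaloisGroup F}
    (hσ₀E : ∀ P : WeierstrassCurve.geomTorsion W (p : ℤ), σ₀ • P = P)
    (hu : ¬ p ∣ κ.twistExponent J σ₀)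
    (N : AddSubgroup (Fin J → WeierstrassCurve.geomTorsion W (p : ℤ)))
    (hN : ∀ (σ : absoluteGaloisGroup F) (x : Fin J → WeierstrassCurve.geomTorsion W (p : ℤ)),
      x ∈ N → W.modPTwist p κ J σ x ∈ N)
    {x : Fin J → WeierstrassCurve.geomTorsion W (p : ℤ)} (hx : x ∈ N) :
    x + shiftEnd (WeierstrassCurve.geomTorsion W (p : ℤ)) J x ∈ N := by
  have hM : ∀ P : WeierstrassCurve.geomTorsion W (p : ℤ), p • P = 0 := fun P =>
    AddSubgroup.torsionBy.nsmul P
  have hJ : J ≤ p ^ J := (Nat.lt_pow_self (Fact.out : p.Prime).one_lt).le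
  set u := κ.twistExponent J σ₀ with hu_def
  -- `σ₀` acts as `(1+S)^u`, so `N` is stable under `(1+S)^u` and its iterates
  have hσ₀ : ∀ y : Fin J → WeierstrassCurve.geomTorsion W (p : ℤ),
      W.modPTwist p κ J σ₀ y = unipotentPow (WeierstrassCurve.geomTorsion W (p : ℤ)) J u y := by
    intro y
    rw [WeierstrassCurve.modPTwist_apply]
    have : (fun i => σ₀ • y i) = y := funext fun i => hσ₀E (y i)
    rw [this]
  have hpow : ∀ (k : ℕ) (y : Fin J → WeierstrassCurve.geomTorsion W (p : ℤ)), y ∈ N →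
      unipotentPow (WeierstrassCurve.geomTorsion W (p : ℤ)) J (u * k) y ∈ N := by
    intro k
    induction k with
    | zero => intro y hy; simpa [unipotentPow_zero] using hy
    | succ k ih =>
      intro y hy
      rw [Nat.mul_succ, unipotentPow_add, Module.End.mul_apply]
      refine ih _ ?_
      rw [← hσ₀]
      exact hN σ₀ y hy
  -- `u` is a unit mod `p^J`: `u * v = 1 + c * p^J`
  have hcop : Nat.Coprime u (p ^ J) :=
    (Nat.Coprime.pow_right J ((Nat.Prime.coprime_iff_not_dvd (Fact.out : p.Prime)).mpr hu).symm)
  obtain ⟨v, hv⟩ : ∃ v : ℕ, u * v % p ^ J = 1 % p ^ J := by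
    haveI : NeZero (p ^ J) := ⟨pow_ne_zero J (Fact.out : p.Prime).ne_zero⟩
    let uu : (ZMod (p ^ J))ˣ := ZMod.unitOfCoprime u hcop
    refine ⟨((uu⁻¹ : (ZMod (p ^ J))ˣ) : ZMod (p ^ J)).val, ?_⟩
    refine (ZMod.natCast_eq_natCast_iff' _ _ _).mp ?_
    rw [Nat.cast_mul, ZMod.natCast_zmod_val, Nat.cast_one]
    change ((uu : ZMod (p ^ J))) * ((uu⁻¹ : (ZMod (p ^ J))ˣ) : ZMod (p ^ J)) = 1
    rw [← Units.val_mul, mul_inv_cancel, Units.val_one]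
  have hmem := hpow v x hx
  -- `(1+S)^{u v} = (1+S)^{(u v) mod p^J} = (1+S)^{1 mod p^J} = (1+S)^1` and `(1+S)^1 x = x + S x`
  have e1 : unipotentPow (WeierstrassCurve.geomTorsion W (p : ℤ)) J (u * v) =
      unipotentPow (WeierstrassCurve.geomTorsion W (p : ℤ)) J 1 := by
    rw [← unipotentPow_mod hM hJ (u * v), hv, unipotentPow_mod hM hJ 1]
  rw [e1] at hmem
  simpa only [unipotentPow, pow_one, LinearMap.add_apply, Module.End.one_apply] using hmem

/-- **MU-TRANSFER-PROOF §4 Lemma 3 (i) on the genuine `𝒯_J(E)`, unit form**: if `E[p]` is irreducible and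
some `σ₀ ∈ Γ_F` fixes `E[p]` with `κ(σ₀) mod p^J` prime to `p`, every `Γ_F`-stable subgroup of `𝒯_J(E)` is
`T^j 𝒯_J(E)`.  (Same proof as `modPTwist_stable_addSubgroup_eq_tPow`, with `1+S`-stability from
`add_shift_mem_of_modPTwist_stable_of_unit`.) [cite: MazurRubin2004, §5.3] -/
theorem modPTwist_stable_addSubgroup_eq_tPow_of_unit (hirr : W.HasIrreducibleModPGaloisRep p)
    {σ₀ : absoluteGaloisGroup F} (hσ₀E : ∀ P : WeierstrassCurve.geomTorsion W (p : ℤ), σ₀ • P = P)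
    (hu : ¬ p ∣ κ.twistExponent J σ₀)
    (N : AddSubgroup (Fin J → WeierstrassCurve.geomTorsion W (p : ℤ)))
    (hN : ∀ (σ : absoluteGaloisGroup F) (x : Fin J → WeierstrassCurve.geomTorsion W (p : ℤ)),
      x ∈ N → W.modPTwist p κ J σ x ∈ N) :
    ∃ j : ℕ, j ≤ J ∧ ∀ x : Fin J → WeierstrassCurve.geomTorsion W (p : ℤ),
      x ∈ N ↔ ∀ i : Fin J, i.val < j → x i = 0 := by
  classical
  letI : Module (ZMod p) (WeierstrassCurve.geomTorsion W (p : ℤ)) := AddSubgroup.torsionBy.zmodModule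
  have hM : ∀ P : WeierstrassCurve.geomTorsion W (p : ℤ), p • P = 0 := fun P =>
    AddSubgroup.torsionBy.nsmul P
  have hJ : J ≤ p ^ J := (Nat.lt_pow_self (Fact.out : p.Prime).one_lt).le
  have hS : ∀ x ∈ N, x + shiftEnd (WeierstrassCurve.geomTorsion W (p : ℤ)) J x ∈ N := fun x hx =>
    add_shift_mem_of_modPTwist_stable_of_unit W p κ J hσ₀E hu N hN hx
  -- diagonal stability: `diag(σ) x = (1+S)^{p^J − κ(σ)} (σ · x)`
  have hdiag : ∀ (σ : absoluteGaloisGroup F) (x : Fin J → WeierstrassCurve.geomTorsion W (p : ℤ)),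
      x ∈ N → (fun i => σ • x i) ∈ N := by
    intro σ x hx
    set a := κ.twistExponent J σ with ha
    have ha_lt : a ≤ p ^ J := by
      rw [ha, ZpExtension.twistExponent]
      exact (ZMod.val_lt _).le
    have key : unipotentPow (WeierstrassCurve.geomTorsion W (p : ℤ)) J (p ^ J - a) (W.modPTwist p κ J σ x) =
        fun i => σ • x i := by
      rw [WeierstrassCurve.modPTwist_apply, ← Module.End.mul_apply, ← unipotentPow_add,
        Nat.sub_add_cancel ha_lt, unipotentPow_prime_pow_eq_one hM hJ, Module.End.one_apply]
    rw [← key]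
    exact unipotentPow_mem_of_add_shift_mem W p J N hS _ (hN σ x hx)
  let ρσ : absoluteGaloisGroup F →
      (WeierstrassCurve.geomTorsion W (p : ℤ) →ₗ[ZMod p] WeierstrassCurve.geomTorsion W (p : ℤ)) :=
    fun σ => (DistribSMul.toAddMonoidHom (WeierstrassCurve.geomTorsion W (p : ℤ)) σ).toZModLinearMap p
  let T : (Fin J → WeierstrassCurve.geomTorsion W (p : ℤ)) →ₗ[ZMod p]
      (Fin J → WeierstrassCurve.geomTorsion W (p : ℤ)) :=
    (shiftEnd (WeierstrassCurve.geomTorsion W (p : ℤ)) J).toAddMonoidHom.toZModLinearMap p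
  let N' : Submodule (ZMod p) (Fin J → WeierstrassCurve.geomTorsion W (p : ℤ)) :=
    AddSubgroup.toZModSubmodule p N
  have hN'mem : ∀ x, x ∈ N' ↔ x ∈ N := fun x => AddSubgroup.mem_toZModSubmodule p
  have hirr' : ∀ W' : Submodule (ZMod p) (WeierstrassCurve.geomTorsion W (p : ℤ)),
      (∀ g ∈ Set.range ρσ, ∀ v ∈ W', g v ∈ W') → W' = ⊥ ∨ W' = ⊤ := by
    intro W' hW'
    have hstab : ∀ σ : absoluteGaloisGroup F, ∀ P ∈ W'.toAddSubgroup, σ • P ∈ W'.toAddSubgroup :=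
      fun σ P hP => hW' (ρσ σ) ⟨σ, rfl⟩ P hP
    rcases hirr W'.toAddSubgroup hstab with h | h
    · left
      apply Submodule.toAddSubgroup_injective
      rw [h, Submodule.bot_toAddSubgroup]
    · right
      apply Submodule.toAddSubgroup_injective
      rw [h, Submodule.top_toAddSubgroup]
  have hT0 : ∀ (x : Fin J → WeierstrassCurve.geomTorsion W (p : ℤ)) (i : Fin J), i.val = 0 → T x i = 0 := by
    intro x i hi
    change shiftEnd (WeierstrassCurve.geomTorsion W (p : ℤ)) J x i = 0
    rw [shiftEnd_apply, dif_pos hi]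
  have hTs : ∀ (x : Fin J → WeierstrassCurve.geomTorsion W (p : ℤ)) (i j : Fin J),
      j.val = i.val + 1 → T x j = x i := by
    intro x i j hij
    change shiftEnd (WeierstrassCurve.geomTorsion W (p : ℤ)) J x j = x i
    rw [shiftEnd_apply, dif_neg (by omega)]
    congr 1
    ext
    simp only [hij, Nat.add_sub_cancel]
  have hNT : ∀ x ∈ N', T x ∈ N' := by
    intro x hx
    rw [hN'mem] at hx ⊢
    change shiftEnd (WeierstrassCurve.geomTorsion W (p : ℤ)) J x ∈ N
    simpa using N.sub_mem (hS x hx) hx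
  have hNS : ∀ g ∈ Set.range ρσ, ∀ x ∈ N', (fun i => g (x i)) ∈ N' := by
    rintro g ⟨σ, rfl⟩ x hx
    rw [hN'mem] at hx ⊢
    exact hdiag σ x hx
  obtain ⟨j, hj, hiff⟩ := shiftStable_submodule_eq_tPow (Set.range ρσ) hirr' T hT0 hTs N' hNT hNS
  exact ⟨j, hj, fun x => (hN'mem x).symm.trans (hiff x)⟩

/-- **Discharge of the unit hypothesis from the image**: if every `σ ∈ Γ_F` satisfies `σ^m = 1` on
`E[p]` for some `m` prime to `p` (e.g. `m = #ρ̄(Γ_F)` for the X9 images 5Ns/5S4/7Ns, of orders 48/96/96),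
then for `J ≥ 1` some `σ₀` fixes `E[p]` with `κ(σ₀) mod p^J` prime to `p`: `σ₀ = γ^m` for any
topological generator `γ` (`κ γ = 1`), since `κ(γ^m) = m`.  MU-TRANSFER-PROOF (F2): "`ℚ(E[p]) ∩ ℚ_∞ = ℚ`".
[cite: Washington1997, §13.1–§13.2] -/
theorem exists_fixing_twistExponent_not_dvd (hJ : 1 ≤ J) {m : ℕ} (hm : ¬ p ∣ m)
    (hfix : ∀ (σ : absoluteGaloisGroup F) (P : WeierstrassCurve.geomTorsion W (p : ℤ)), (σ ^ m) • P = P)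
    {γ : absoluteGaloisGroup F} (hγ : κ.IsTopGenerator γ) :
    ∃ σ₀ : absoluteGaloisGroup F,
      (∀ P : WeierstrassCurve.geomTorsion W (p : ℤ), σ₀ • P = P) ∧ ¬ p ∣ κ.twistExponent J σ₀ := by
  refine ⟨γ ^ m, fun P => hfix γ P, ?_⟩
  have hκ : (κ (γ ^ m)).toAdd = (m : ℤ_[p]) := by
    rw [map_pow, show κ γ = Multiplicative.ofAdd 1 from hγ, ← ofAdd_nsmul, toAdd_ofAdd, nsmul_eq_mul,
      mul_one]
  rw [ZpExtension.twistExponent, hκ, map_natCast, ZMod.val_natCast]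
  -- `p ∣ m % p^J ↔ p ∣ m` since `p ∣ p^J` (`J ≥ 1`)
  intro hdvd
  apply hm
  have hpJ : p ∣ p ^ J := dvd_pow_self p (by omega)
  have h := dvd_add hdvd (Dvd.dvd.mul_right hpJ (m / p ^ J))
  rwa [Nat.mod_add_div] at h

end Summit.BirchSwinnertonDyer.BirchSwinnertonDyer.Rank1Residual.LevelE

end
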